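import Summits.ValiantsHypothesis.ValiantsHypothesis.Theorems.AnyonJetsUniformJetUpperBoundPoints
import Summits.ValiantsHypothesis.ValiantsHypothesis.Theorems.FermionicJetJetsInVNPGadgets

/-!
# Route `AnyonJets`, crux `UniformJetUpperBound` (stmt-ValiantsHypothesis-16739) — helper file 1b:
# the inversion pencil with a VARIABLE coupling is p-definable (registered stub `stub_pencilVNP`)

The crux asks: `VP_ℂ = VNP_ℂ ⟹ ∃ c n₀, ∀ n ≥ n₀, ∀ k, L_ℂ(J_{n,k}) ≤ n^c` for the inversion jets
`J_{n,k} = ∑_σ sgn σ · binom(inv σ, k) · ∏ᵢ X_{σ i, i}`. The registered line `birth`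
(`Cruxes/UniformJetUpperBound/Lines/birth.lean`) splits it into `stub_pencilVNP` (the inversion /
Mahonian pencil with the coupling `q` an extra VARIABLE,

  `P_n(q; X) = ∑_σ q^{inv σ} ∏ᵢ X_{σ i, i} ∈ K[q, X_{ij}]`   (variables `Option (Fin n × Fin n)`, `q = X none`),

is a `VNP` family) and `stub_jetTaylor` (the jets are `±` the `u`-coefficients of `P_n(u-1; X)`),
composed with the landed interpolation lemma. This file proves the mathematics of the first stub,
**`(P_n)_n ∈ VNP` over every commutative ring `K`** (`isVNPFamily_pencil`), literally in the format
of Bürgisser 2000, Def. 2.5; the stub itself (`K = ℂ`, verbatim signature) is restated in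
`AnyonJetsUniformJetUpperBoundStubPencilVNP.lean`.

## The witness (no new definitions; all terms inline)

Boolean block: an `n × n` position matrix `Z` (variable `Sum.inr (finProdFinEquiv (t, i))`, "is
`σ t = i`"), recognised by BCS's `α(Z) β(Z)` (`conflictPairs`, `sum_recogniser_mul` of
`HamiltonianCycleVNP.lean`: Boolean sums against the recogniser are sums over permutation matrices
`P_σ`). The witness is

  `G_n = α(Z) β(Z) · (∏_{a<b} (1 + (q - 1) · ∑_{j<i} Z_{(a,i)} Z_{(b,j)}) · ∏_t ∑_i Z_{(t,i)} X_{(i,t)})`.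

At `P_σ` the INVERSION GADGET `∑_{j<i} Z_{(a,i)} Z_{(b,j)}` is `[σ b < σ a]`, so the middle product
is `∏_{(a,b) inversion} q = q^{inv σ}`, and the cover product is `∏_t X_{σ t, t}`; hence
`∑_{e ∈ {0,1}^{n²}} G_n(q, X, e) = P_n` (`boolSum_witness`; point evaluations in helper file 1a).
`G_n` has `2n² + 1` variables, degree `≤ 6(n+1)⁴` and size `≤ 13(n+1)⁴` (`totalDegree_witness_le`,
`complexity_witness_le`), so `(G_n) ∈ VP` and `(P_n) ∈ VNP`. HONEST FRAMING: a transcription of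
Valiant 1979 / Bürgisser 2000, Prop. 2.20 for one explicit family, serving a dormant route; nothing
here bears on `VP ≠ VNP`.

References: L. G. Valiant, *Completeness classes in algebra*, STOC 1979, §4; P. Bürgisser,
*Completeness and Reduction in Algebraic Complexity Theory*, Springer 2000, Def. 2.3–2.5,
Prop. 2.20; P. Bürgisser, M. Clausen, M. A. Shokrollahi, *Algebraic Complexity Theory*, Springer
1997, Prop. (21.15) (the recogniser).
-/

noncomputable section

-- single-conjunct layout: Sub = Summit, duplicated namespace component intended
set_option linter.dupNamespace false

namespace Summit.ValiantsHypothesis.ValiantsHypothesis.Theorems.AnyonJets.UniformJet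

open Literature.Computability.AlgebraicComplexity MvPolynomial Equiv Finset
open Summit.ValiantsHypothesis.ValiantsHypothesis.Theorems.FermionicJetJetsInVNP (pow_le_pow_succ)

/-! ### The witness: Boolean sum, degree, size -/

section Witness

variable (K : Type*) [CommRing K] (n : ℕ)

/-- **The Boolean sum of the witness is the inversion pencil**:
`∑_{e ∈ {0,1}^{n²}} G_n(q, X, e) = ∑_σ q^{inv σ} ∏ᵢ X_{σ i, i}` (BCS 1997, Prop. (21.15): (A)–(D) for
the recogniser; the gadgets at `P_σ`). [folklore] -/
theorem boolSum_witness :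
    boolSum ((∏ pq ∈ conflictPairs n, (1 - X (Sum.inr (finProdFinEquiv pq.1)) *
          X (Sum.inr (finProdFinEquiv pq.2)))) *
        (∏ t : Fin n, ∑ i : Fin n, X (Sum.inr (finProdFinEquiv (t, i)))) *
        ((∏ ab ∈ Finset.univ.filter (fun ab : Fin n × Fin n => ab.1 < ab.2),
          (1 + ((X (Sum.inl none) : MvPolynomial (Option (Fin n × Fin n) ⊕ Fin (n * n)) K) - 1) *
            ∑ ij ∈ Finset.univ.filter (fun ij : Fin n × Fin n => ij.2 < ij.1),
              X (Sum.inr (finProdFinEquiv (ab.1, ij.1))) *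
                X (Sum.inr (finProdFinEquiv (ab.2, ij.2))))) *
          ∏ t : Fin n, ∑ i : Fin n, X (Sum.inr (finProdFinEquiv (t, i))) *
            X (Sum.inl (some (i, t)))) :
      MvPolynomial (Option (Fin n × Fin n) ⊕ Fin (n * n)) K) =
      ∑ σ : Perm (Fin n), (X none : MvPolynomial (Option (Fin n × Fin n)) K) ^
          (Finset.univ.filter (fun p : Fin n × Fin n => p.1 < p.2 ∧ σ p.2 < σ p.1)).card *
        ∏ i : Fin n, X (some (σ i, i)) := by
  rw [boolSum_eq_sum_matrices]
  simp only [map_mul₄, aeval_point_alpha, aeval_point_beta]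
  refine (sum_recogniser_mul _).trans ?_
  refine Finset.sum_congr rfl fun σ _ => ?_
  rw [aeval_point_gadget, aeval_point_cover]

/-- `deg (1 + (q - 1) · ∑ Z Z) ≤ 3`. [folklore] -/
theorem totalDegree_factor_le (ab : Fin n × Fin n) :
    ((1 + ((X (Sum.inl none) : MvPolynomial (Option (Fin n × Fin n) ⊕ Fin (n * n)) K) - 1) *
        ∑ ij ∈ Finset.univ.filter (fun ij : Fin n × Fin n => ij.2 < ij.1),
          X (Sum.inr (finProdFinEquiv (ab.1, ij.1))) * X (Sum.inr (finProdFinEquiv (ab.2, ij.2)))) :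
      MvPolynomial (Option (Fin n × Fin n) ⊕ Fin (n * n)) K).totalDegree ≤ 3 := by
  refine (totalDegree_add _ _).trans (max_le ?_ ?_)
  · rw [totalDegree_one]; exact Nat.zero_le _
  refine (totalDegree_mul _ _).trans ?_
  have h1 : (X (Sum.inl none) - 1 :
      MvPolynomial (Option (Fin n × Fin n) ⊕ Fin (n * n)) K).totalDegree ≤ 1 :=
    (totalDegree_sub _ _).trans (max_le (totalDegree_X_le_one _) (by rw [totalDegree_one]; exact Nat.zero_le _))
  have h2 : (∑ ij ∈ Finset.univ.filter (fun ij : Fin n × Fin n => ij.2 < ij.1),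
      X (Sum.inr (finProdFinEquiv (ab.1, ij.1))) * X (Sum.inr (finProdFinEquiv (ab.2, ij.2))) :
      MvPolynomial (Option (Fin n × Fin n) ⊕ Fin (n * n)) K).totalDegree ≤ 2 :=
    totalDegree_sum_le_of_le _ _ 2 fun ij _ =>
      (totalDegree_mul _ _).trans (add_le_add (totalDegree_X_le_one _) (totalDegree_X_le_one _))
  omega

/-- **Degree of the witness**: `≤ 6(n+1)⁴`. [folklore] -/
theorem totalDegree_witness_le :
    ((∏ pq ∈ conflictPairs n, (1 - X (Sum.inr (finProdFinEquiv pq.1)) *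
          X (Sum.inr (finProdFinEquiv pq.2)))) *
        (∏ t : Fin n, ∑ i : Fin n, X (Sum.inr (finProdFinEquiv (t, i)))) *
        ((∏ ab ∈ Finset.univ.filter (fun ab : Fin n × Fin n => ab.1 < ab.2),
          (1 + ((X (Sum.inl none) : MvPolynomial (Option (Fin n × Fin n) ⊕ Fin (n * n)) K) - 1) *
            ∑ ij ∈ Finset.univ.filter (fun ij : Fin n × Fin n => ij.2 < ij.1),
              X (Sum.inr (finProdFinEquiv (ab.1, ij.1))) *
                X (Sum.inr (finProdFinEquiv (ab.2, ij.2))))) *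
          ∏ t : Fin n, ∑ i : Fin n, X (Sum.inr (finProdFinEquiv (t, i))) *
            X (Sum.inl (some (i, t)))) :
      MvPolynomial (Option (Fin n × Fin n) ⊕ Fin (n * n)) K).totalDegree ≤ 6 * (n + 1) ^ 4 := by
  have hA : (∏ pq ∈ conflictPairs n, (1 - X (Sum.inr (finProdFinEquiv pq.1)) *
      X (Sum.inr (finProdFinEquiv pq.2))) :
      MvPolynomial (Option (Fin n × Fin n) ⊕ Fin (n * n)) K).totalDegree ≤ n ^ 4 * 2 :=
    (totalDegree_prod_le_of_le _ _ _ fun _ _ => totalDegree_one_sub_X_mul_X_le _ _).trans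
      (Nat.mul_le_mul_right 2 (card_conflictPairs_le _))
  have hB : (∏ t : Fin n, ∑ i : Fin n, X (Sum.inr (finProdFinEquiv (t, i))) :
      MvPolynomial (Option (Fin n × Fin n) ⊕ Fin (n * n)) K).totalDegree ≤ n * 1 :=
    (totalDegree_prod_le_of_le _ _ _ fun _ _ =>
      totalDegree_sum_le_of_le _ _ _ fun _ _ => totalDegree_X_le_one _).trans (by simp)
  have hcard : (Finset.univ.filter (fun ab : Fin n × Fin n => ab.1 < ab.2)).card ≤ n * n :=
    (Finset.card_filter_le _ _).trans (by simp)
  have hG : (∏ ab ∈ Finset.univ.filter (fun ab : Fin n × Fin n => ab.1 < ab.2),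
      (1 + ((X (Sum.inl none) : MvPolynomial (Option (Fin n × Fin n) ⊕ Fin (n * n)) K) - 1) *
        ∑ ij ∈ Finset.univ.filter (fun ij : Fin n × Fin n => ij.2 < ij.1),
          X (Sum.inr (finProdFinEquiv (ab.1, ij.1))) * X (Sum.inr (finProdFinEquiv (ab.2, ij.2)))) :
      MvPolynomial (Option (Fin n × Fin n) ⊕ Fin (n * n)) K).totalDegree ≤ n * n * 3 :=
    (totalDegree_prod_le_of_le _ _ 3 fun ab _ => totalDegree_factor_le K n ab).trans
      (Nat.mul_le_mul_right 3 hcard)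
  have hV : (∏ t : Fin n, ∑ i : Fin n, X (Sum.inr (finProdFinEquiv (t, i))) *
      X (Sum.inl (some (i, t))) :
      MvPolynomial (Option (Fin n × Fin n) ⊕ Fin (n * n)) K).totalDegree ≤ n * 2 := by
    refine (totalDegree_prod_le_of_le _ _ 2 fun t _ =>
      totalDegree_sum_le_of_le _ _ 2 fun i _ => ?_).trans (by simp)
    exact (totalDegree_mul _ _).trans (add_le_add (totalDegree_X_le_one _) (totalDegree_X_le_one _))
  refine (totalDegree_mul _ _).trans ((add_le_add ((totalDegree_mul _ _).trans (add_le_add hA hB))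
    ((totalDegree_mul _ _).trans (add_le_add hG hV))).trans ?_)
  have e1 : n ^ 4 ≤ (n + 1) ^ 4 := pow_le_pow_succ n le_rfl
  have e2 : n ≤ (n + 1) ^ 4 := (pow_one n).symm.le.trans (pow_le_pow_succ n (by norm_num))
  have e3 : n * n ≤ (n + 1) ^ 4 := (sq n).symm.le.trans (pow_le_pow_succ n (by norm_num))
  nlinarith

/-- `L(1 + (q - 1) · ∑_{j<i} Z_{(a,i)} Z_{(b,j)}) ≤ 2n² + 5`. [folklore] -/
theorem complexity_factor_le (ab : Fin n × Fin n) :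
    complexity ((1 + ((X (Sum.inl none) : MvPolynomial (Option (Fin n × Fin n) ⊕ Fin (n * n)) K) - 1) *
        ∑ ij ∈ Finset.univ.filter (fun ij : Fin n × Fin n => ij.2 < ij.1),
          X (Sum.inr (finProdFinEquiv (ab.1, ij.1))) * X (Sum.inr (finProdFinEquiv (ab.2, ij.2)))) :
      MvPolynomial (Option (Fin n × Fin n) ⊕ Fin (n * n)) K) ≤ 2 * (n * n) + 5 := by
  have hcard : (Finset.univ.filter (fun ij : Fin n × Fin n => ij.2 < ij.1)).card ≤ n * n :=
    (Finset.card_filter_le _ _).trans (by simp)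
  have hS : complexity (∑ ij ∈ Finset.univ.filter (fun ij : Fin n × Fin n => ij.2 < ij.1),
      X (Sum.inr (finProdFinEquiv (ab.1, ij.1))) * X (Sum.inr (finProdFinEquiv (ab.2, ij.2))) :
      MvPolynomial (Option (Fin n × Fin n) ⊕ Fin (n * n)) K) ≤ n * n * 1 + n * n := by
    refine (complexity_sum_le_of_le _ _ 1 fun ij _ => ?_).trans
      (add_le_add (Nat.mul_le_mul_right 1 hcard) hcard)
    have h1 := complexity_mul_le_holds
      (X (Sum.inr (finProdFinEquiv (ab.1, ij.1))) : MvPolynomial (Option (Fin n × Fin n) ⊕ Fin (n * n)) K)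
      (X (Sum.inr (finProdFinEquiv (ab.2, ij.2))))
    have h2 := complexity_X_holds (k := K)
      (Sum.inr (finProdFinEquiv (ab.1, ij.1)) : Option (Fin n × Fin n) ⊕ Fin (n * n))
    have h3 := complexity_X_holds (k := K)
      (Sum.inr (finProdFinEquiv (ab.2, ij.2)) : Option (Fin n × Fin n) ⊕ Fin (n * n))
    omega
  have hU : complexity (X (Sum.inl none) - 1 :
      MvPolynomial (Option (Fin n × Fin n) ⊕ Fin (n * n)) K) ≤ 1 := by
    have h1 := complexity_add_le_holds
      (X (Sum.inl none) : MvPolynomial (Option (Fin n × Fin n) ⊕ Fin (n * n)) K) (C (-1))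
    have h2 := complexity_X_holds (k := K) (Sum.inl none : Option (Fin n × Fin n) ⊕ Fin (n * n))
    have h3 := complexity_C_holds (σ := Option (Fin n × Fin n) ⊕ Fin (n * n)) (-1 : K)
    have e : (X (Sum.inl none) : MvPolynomial (Option (Fin n × Fin n) ⊕ Fin (n * n)) K) + C (-1) =
        X (Sum.inl none) - 1 := by
      rw [map_neg, map_one, ← sub_eq_add_neg]
    rw [e] at h1
    omega
  have hadd : ∀ f : MvPolynomial (Option (Fin n × Fin n) ⊕ Fin (n * n)) K,
      complexity (1 + f) ≤ complexity f + 1 := by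
    intro f
    have h1 := complexity_add_le_holds (C 1 : MvPolynomial (Option (Fin n × Fin n) ⊕ Fin (n * n)) K) f
    have h4 := complexity_C_holds (σ := Option (Fin n × Fin n) ⊕ Fin (n * n)) (1 : K)
    rw [h4, map_one] at h1
    omega
  refine (hadd _).trans ?_
  have hM := complexity_mul_le_holds
    (X (Sum.inl none) - 1 : MvPolynomial (Option (Fin n × Fin n) ⊕ Fin (n * n)) K)
    (∑ ij ∈ Finset.univ.filter (fun ij : Fin n × Fin n => ij.2 < ij.1),
      X (Sum.inr (finProdFinEquiv (ab.1, ij.1))) * X (Sum.inr (finProdFinEquiv (ab.2, ij.2))))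
  omega

/-- **Size of the witness**: `≤ 13(n+1)⁴`. [folklore] -/
theorem complexity_witness_le :
    complexity ((∏ pq ∈ conflictPairs n, (1 - X (Sum.inr (finProdFinEquiv pq.1)) *
          X (Sum.inr (finProdFinEquiv pq.2)))) *
        (∏ t : Fin n, ∑ i : Fin n, X (Sum.inr (finProdFinEquiv (t, i)))) *
        ((∏ ab ∈ Finset.univ.filter (fun ab : Fin n × Fin n => ab.1 < ab.2),
          (1 + ((X (Sum.inl none) : MvPolynomial (Option (Fin n × Fin n) ⊕ Fin (n * n)) K) - 1) *
            ∑ ij ∈ Finset.univ.filter (fun ij : Fin n × Fin n => ij.2 < ij.1),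
              X (Sum.inr (finProdFinEquiv (ab.1, ij.1))) *
                X (Sum.inr (finProdFinEquiv (ab.2, ij.2))))) *
          ∏ t : Fin n, ∑ i : Fin n, X (Sum.inr (finProdFinEquiv (t, i))) *
            X (Sum.inl (some (i, t)))) :
      MvPolynomial (Option (Fin n × Fin n) ⊕ Fin (n * n)) K) ≤ 13 * (n + 1) ^ 4 := by
  have hA : complexity (∏ pq ∈ conflictPairs n, (1 - X (Sum.inr (finProdFinEquiv pq.1)) *
      X (Sum.inr (finProdFinEquiv pq.2))) :
      MvPolynomial (Option (Fin n × Fin n) ⊕ Fin (n * n)) K) ≤ n ^ 4 * 3 + n ^ 4 := by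
    refine (complexity_prod_le_of_le _ _ _ fun _ _ => complexity_one_sub_X_mul_X_le _ _).trans ?_
    have h := card_conflictPairs_le n
    gcongr
  have hB : complexity (∏ t : Fin n, ∑ i : Fin n, X (Sum.inr (finProdFinEquiv (t, i))) :
      MvPolynomial (Option (Fin n × Fin n) ⊕ Fin (n * n)) K) ≤ n * (n * 0 + n) + n :=
    (complexity_prod_le_of_le _ _ _ fun _ _ => complexity_sum_le_of_le _ _ _ fun _ _ =>
      le_of_eq (complexity_X_holds (k := K) _)).trans (by simp)
  have hcard : (Finset.univ.filter (fun ab : Fin n × Fin n => ab.1 < ab.2)).card ≤ n * n :=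
    (Finset.card_filter_le _ _).trans (by simp)
  have hG : complexity (∏ ab ∈ Finset.univ.filter (fun ab : Fin n × Fin n => ab.1 < ab.2),
      (1 + ((X (Sum.inl none) : MvPolynomial (Option (Fin n × Fin n) ⊕ Fin (n * n)) K) - 1) *
        ∑ ij ∈ Finset.univ.filter (fun ij : Fin n × Fin n => ij.2 < ij.1),
          X (Sum.inr (finProdFinEquiv (ab.1, ij.1))) * X (Sum.inr (finProdFinEquiv (ab.2, ij.2)))) :
      MvPolynomial (Option (Fin n × Fin n) ⊕ Fin (n * n)) K) ≤
      n * n * (2 * (n * n) + 5) + n * n :=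
    (complexity_prod_le_of_le _ _ _ fun ab _ => complexity_factor_le K n ab).trans
      (add_le_add (Nat.mul_le_mul_right _ hcard) hcard)
  have hV : complexity (∏ t : Fin n, ∑ i : Fin n,
      X (Sum.inr (finProdFinEquiv (t, i))) * X (Sum.inl (some (i, t))) :
      MvPolynomial (Option (Fin n × Fin n) ⊕ Fin (n * n)) K) ≤ n * (n * 1 + n) + n := by
    refine (complexity_prod_le_of_le _ _ _ fun t _ =>
      complexity_sum_le_of_le _ _ 1 fun i _ => ?_).trans (by simp)
    have h1 := complexity_mul_le_holds
      (X (Sum.inr (finProdFinEquiv (t, i))) : MvPolynomial (Option (Fin n × Fin n) ⊕ Fin (n * n)) K)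
      (X (Sum.inl (some (i, t))))
    have h2 := complexity_X_holds (k := K) (Sum.inr (finProdFinEquiv (t, i)) :
      Option (Fin n × Fin n) ⊕ Fin (n * n))
    have h3 := complexity_X_holds (k := K) (Sum.inl (some (i, t)) : Option (Fin n × Fin n) ⊕ Fin (n * n))
    omega
  refine (complexity_mul_le_holds _ _).trans ?_
  refine (Nat.succ_le_succ (add_le_add ((complexity_mul_le_holds _ _).trans
    (Nat.succ_le_succ (add_le_add hA hB)))
    ((complexity_mul_le_holds _ _).trans (Nat.succ_le_succ (add_le_add hG hV))))).trans ?_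
  have e1 : n ^ 4 ≤ (n + 1) ^ 4 := pow_le_pow_succ n le_rfl
  have e2 : n ≤ (n + 1) ^ 4 := (pow_one n).symm.le.trans (pow_le_pow_succ n (by norm_num))
  have e3 : n * n ≤ (n + 1) ^ 4 := (sq n).symm.le.trans (pow_le_pow_succ n (by norm_num))
  have e4 : n * n * (n * n) = n ^ 4 := by ring
  have e5 : 1 ≤ (n + 1) ^ 4 := Nat.one_le_pow _ _ n.succ_pos
  nlinarith

/-- **The `VNP` witness for the inversion pencil**, Boolean block `Fin (n·n)`: degree
`≤ 6(n+1)⁴`, size `≤ 13(n+1)⁴`, Boolean sum `P_n`. [folklore] -/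
theorem exists_witness :
    ∃ g : MvPolynomial (Option (Fin n × Fin n) ⊕ Fin (n * n)) K,
      g.totalDegree ≤ 6 * (n + 1) ^ 4 ∧ complexity g ≤ 13 * (n + 1) ^ 4 ∧
        boolSum g = ∑ σ : Perm (Fin n), (X none : MvPolynomial (Option (Fin n × Fin n)) K) ^
          (Finset.univ.filter (fun p : Fin n × Fin n => p.1 < p.2 ∧ σ p.2 < σ p.1)).card *
        ∏ i : Fin n, X (some (σ i, i)) :=
  ⟨_, totalDegree_witness_le K n, complexity_witness_le K n, boolSum_witness K n⟩

end Witness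

/-! ### The family -/

section Family

variable (K : Type*) [CommRing K]

/-- `deg P_n ≤ n(n-1)/2 + n` (each term is `q^{inv σ} · ∏_{i<n} X_{σ i, i}` and
`inv σ ≤ n(n-1)/2`, `card_inversions_le`). [folklore] -/
theorem totalDegree_pencil_le (n : ℕ) :
    (∑ σ : Perm (Fin n), (X none : MvPolynomial (Option (Fin n × Fin n)) K) ^
          (Finset.univ.filter (fun p : Fin n × Fin n => p.1 < p.2 ∧ σ p.2 < σ p.1)).card *
        ∏ i : Fin n, X (some (σ i, i)) : MvPolynomial (Option (Fin n × Fin n)) K).totalDegree ≤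
      n * (n - 1) / 2 + n := by
  refine totalDegree_sum_le_of_le _ _ _ fun σ _ => (totalDegree_mul _ _).trans (add_le_add ?_ ?_)
  · refine (totalDegree_pow _ _).trans ?_
    have h1 : ((X none : MvPolynomial (Option (Fin n × Fin n)) K)).totalDegree ≤ 1 :=
      totalDegree_X_le_one _
    have h2 := card_inversions_le σ
    calc (Finset.univ.filter (fun p : Fin n × Fin n => p.1 < p.2 ∧ σ p.2 < σ p.1)).card *
          ((X none : MvPolynomial (Option (Fin n × Fin n)) K)).totalDegree
        ≤ (n * (n - 1) / 2) * 1 := Nat.mul_le_mul h2 h1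
      _ = n * (n - 1) / 2 := mul_one _
  · exact (totalDegree_prod_le_of_le _ _ 1 fun _ _ => totalDegree_X_le_one _).trans (by simp)

/-- **The inversion pencil is a p-family**: `n² + 1` variables, degree `≤ n(n-1)/2 + n ≤ (n+1)²`.
[folklore] -/
theorem isPFamily_pencil :
    IsPFamily (σ := fun n => Option (Fin n × Fin n)) fun n =>
      (∑ σ : Perm (Fin n), (X none : MvPolynomial (Option (Fin n × Fin n)) K) ^
          (Finset.univ.filter (fun p : Fin n × Fin n => p.1 < p.2 ∧ σ p.2 < σ p.1)).card *
        ∏ i : Fin n, X (some (σ i, i)) : MvPolynomial (Option (Fin n × Fin n)) K) := by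
  refine ⟨(IsPBounded.iff_exists_le_mul_succ_pow _).2 ⟨1, 2, fun n => ?_⟩,
    (IsPBounded.iff_exists_le_mul_succ_pow _).2 ⟨1, 2, fun n => (totalDegree_pencil_le K n).trans ?_⟩⟩
  · have h : 1 * (n + 1) ^ 2 = n * n + 2 * n + 1 := by ring
    simp only [Fintype.card_option, Fintype.card_prod, Fintype.card_fin]
    omega
  · have h : 1 * (n + 1) ^ 2 = n * n + 2 * n + 1 := by ring
    have h2 : n * (n - 1) / 2 ≤ n * n := (Nat.div_le_self _ _).trans (Nat.mul_le_mul_left n (Nat.sub_le n 1))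
    omega

/-- **The inversion pencil with variable coupling is p-definable** over every commutative ring:
`(P_n)_n = (∑_σ q^{inv σ} ∏ᵢ X_{σ i, i})_n ∈ VNP` — Valiant's criterion in the format of
Bürgisser 2000, Def. 2.5: `P_n` is the Boolean sum of length `n²` of a `VP` witness
(`exists_witness`). [cite: Burgisser2000, Def. 2.5 and Prop. 2.20] [cite: Valiant1979, §4] -/
theorem isVNPFamily_pencil :
    IsVNPFamily (σ := fun n => Option (Fin n × Fin n)) fun n =>
      (∑ σ : Perm (Fin n), (X none : MvPolynomial (Option (Fin n × Fin n)) K) ^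
          (Finset.univ.filter (fun p : Fin n × Fin n => p.1 < p.2 ∧ σ p.2 < σ p.1)).card *
        ∏ i : Fin n, X (some (σ i, i)) : MvPolynomial (Option (Fin n × Fin n)) K) := by
  choose g hdeg hcomp hsum using fun n => exists_witness K n
  refine ⟨isPFamily_pencil K, fun n => n * n, g,
    ⟨⟨(IsPBounded.iff_exists_le_mul_succ_pow _).2 ⟨2, 2, fun n => ?_⟩,
      (IsPBounded.iff_exists_le_mul_succ_pow _).2 ⟨6, 4, hdeg⟩⟩,
      (IsPBounded.iff_exists_le_mul_succ_pow _).2 ⟨13, 4, hcomp⟩⟩, fun n => (hsum n).symm⟩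
  have h : 2 * (n + 1) ^ 2 = 2 * (n * n) + 4 * n + 2 := by ring
  simp only [Fintype.card_sum, Fintype.card_option, Fintype.card_prod, Fintype.card_fin]
  omega

end Family

end Summit.ValiantsHypothesis.ValiantsHypothesis.Theorems.AnyonJets.UniformJet

end
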